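import Summits.BirchSwinnertonDyer.BirchSwinnertonDyer.Theorems.SemiOrdinaryEisensteinDescentWildSplitEisensteinInclusionAtThreeRankOneRestriction
import Summits.BirchSwinnertonDyer.BirchSwinnertonDyer.Theorems.UniversalToricDescentLowerHalfOfPoitouTate
import HarnessLib

/-!
# Route `SemiOrdinaryEisensteinDescent` (SOED): its deciding chain needs the shared control crux #5 `WildSplitControlAtThree`
# (stmt-BirchSwinnertonDyer-20386) ONLY through the `≤` half — which is closed modulo `poitouTate_selmerStructure_duality`
# alone; so SOED's leaf ⟸ PublishedInputs → E′ → Ko → V → PT1 → Z → NT, crux #5 REPLACED by one by-name published fact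

Cell `bsd-wall` (W-ALL row 2·3@3, lane 3), seat `bsd-wall-utd-p3` (prover, gen 6), 2026-08-28 (`--supports 20386`; bears on
route SOED's `closes (hIn hE' hKo hV hC hZ hNT hK')` and on UTD, which shares crux #5).

READING MADE A THEOREM. The SOED kernel (bed-p3 g1 `semiOrdinaryEisensteinDescent_eisensteinKernelAtThree_proof`; soed-p1-w3 g2's
`E′`-fed re-run `wAllExclAddWildRankOneSurj_of_valueAtOneRestricted`, p588074) consumes crux #5 (the pointwise control EQUALITY) in
exactly two places: (i) its CTL₀ conjunct, as the torsion guard of the Eisenstein residual; (ii) the count, in K1's STEP L link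
`indexLowerBoundLeAt_of_imcLowerLe_of_control` — whose proof needs only `ord₃ f(0) ≤ …`. The UPPER index socket is the Kolyvagin crux
`WildKolyvaginUpperAtThree` itself (point currency; no control). Hence the whole SOED kernel runs on the `≤` half
`SchneiderFreeControlAtoms.AdditiveControlLeOnTreeAt 3 κ 𝔭 γ (embAt K 3 𝔭) 0 P`, and that half holds on the entire wild cell from
PT1 alone (this seat: `AdditiveRankOneControlLe.additiveControlLeOnTreeAt_of_poitouTate_of_heegner`, p593079;
`UniversalToricDescentLowerHalf.wildSplitControlLeAtThree_of_poitouTate`, p593492).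

* §1 `wAllExclAddWildRankOneSurj_of_valueAtOneRestricted_of_controlLe` — p588074's kernel VERBATIM with `hC` re-typed to the
  `≤` supplier; `wAllExclAddWildRankOneSurj_of_restricted_of_controlLe` (E′-fed).
* §2 **`wAllExclAddWildRankOneSurj_of_restricted_of_poitouTate`**: `PublishedInputsWildThree → E′ (24155) → Ko (20480) → V (20385)
  → (∀ K, poitouTate_selmerStructure_duality K) → Z (20387) → NT (20484) → WAllExclAddWildRankOneSurj` — SOED's `closes` chain with
  crux #5 replaced by PT1; `wAllExclAddWildRankOneSurj_of_eisenstein_of_poitouTate` (E 20479 instead of E′). (The filed kernel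
  item 24156 is recovered from §1 by `AdditiveRankOneControlLe.additiveControlLeOnTreeAt_zero_of_onTreeAt`; not restated.)

CONSEQUENCE FOR THE PEN (record; no edit performed here): in route SOED, crux #5 can be retyped as its `≤` half (closable now by
`exact UniversalToricDescentLowerHalf.wildSplitControlLeAtThree_of_poitouTate hPT` modulo the by-name fact PT1) or replaced by the
support item 20461 `PoitouTateSelmerStructureDualityFact` outright; `poitouTate_sha_tateDual` (20462), Serre 1967 (20467), Brink
(20465/20466), local Euler–Poincaré (20463), cd ≤ 2 (20464) then leave SOED's cone. In route UTD the kernel 20390 still needs the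
`≥` half for its UPPER socket (see `UniversalToricDescentLowerHalfOfPoitouTate.lean`).

HONEST FRAMING: CONDITIONAL on the displayed antecedents (SOED's research cruxes E′/Ko/V/Z/NT, PT1, print binders); theorems only;
closes no item by name; BSD is not proved for any curve.

References: [JetchevSkinnerWan2017] §7.4.1, Thm. 3.3.1; [Castella2018] Thm. 2.3, §5; [MilneADT2006] I Thm. 4.10(b);
[Howard2004HeegnerKolyvagin] Thm. 2.1.11; [GrossZagier1986] Thm. I.(6.3), V.§2; [FriedbergHoffstein1995] Thm. B; [Kolyvagin1990] Thm. A.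
-/

noncomputable section

open scoped Classical

set_option linter.dupNamespace false
set_option autoImplicit false

namespace Summit.BirchSwinnertonDyer.BirchSwinnertonDyer.Theorems.SemiOrdinaryEisensteinDescentControlLe

open WeierstrassCurve NumberField IsDedekindDomain Field PowerSeries
  Literature.NumberTheory.EllipticCurves
  Literature.NumberTheory.EllipticCurves.ModularForms
  Literature.NumberTheory.EllipticCurves.Rank1Residual
  Literature.NumberTheory.EllipticCurves.KrizLi2019
  Literature.NumberTheory.GaloisCohomology
  Summit.BirchSwinnertonDyer.Rank1Residual
  Summit.BirchSwinnertonDyer.Rank1Residual.Additive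
  Summit.BirchSwinnertonDyer.Rank1Residual.X11b
  Summit.BirchSwinnertonDyer.Rank1Residual.X11b.AcSelmer
  Summit.BirchSwinnertonDyer.Rank1Residual.X11b.Halves
  Summit.BirchSwinnertonDyer.BirchSwinnertonDyer.Theses.SemiOrdinaryEisensteinDescent
  Summit.BirchSwinnertonDyer.BirchSwinnertonDyer.Theorems
  Summit.BirchSwinnertonDyer.BirchSwinnertonDyer.Theorems.WildSplitEisensteinInclusionAtThreeValueAtOne
  Summit.BirchSwinnertonDyer.BirchSwinnertonDyer.Theorems.WildSplitEisensteinInclusionAtThreeRankOneRestriction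
  Summit.BirchSwinnertonDyer.BirchSwinnertonDyer.Theorems.SchneiderFreeControlAtoms
  Summit.BirchSwinnertonDyer.BirchSwinnertonDyer.Theorems.AdditiveRankOneControlLe

/-! ## §1 The SOED kernel with control as `≤` -/

/-- **The SOED kernel needs control ONLY as `≤`.** soed-p1-w3 g2's kernel re-run
`wAllExclAddWildRankOneSurj_of_valueAtOneRestricted` (p588074; = bed-p3 g1's `EisensteinKernelAtThree` proof with the
Eisenstein step fed by `E_𝟙′`) VERBATIM, with the control crux `hC : WildSplitControlAtThree` (crux #5, the pointwise
EQUALITY) replaced by a supplier of its `≤` HALF `SchneiderFreeControlAtoms.AdditiveControlLeOnTreeAt 3 κ 𝔭 γ (embAt K 3 𝔭) 0 P`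
in the same binders. The proof used `hC` twice: its CTL₀ conjunct as the torsion guard of the Eisenstein residual, and the
count in K1's STEP L link — which needs `≤` only (`AdditiveRankOneControlLe.indexLowerBoundLeAt_of_imcLowerLe_of_controlLe_zero`);
the UPPER index socket is the Kolyvagin crux `WildKolyvaginUpperAtThree` itself (no control). Conclusion unchanged:
`WAllExclAddWildRankOneSurj`. Every crux an antecedent; BSD is not proved by this.
[cite: JetchevSkinnerWan2017, §7.4.1 (arXiv:1512.06894 p. 30)] [cite: Castella2018, Thm. 2.3 and §5 (5.1)–(5.3)]
[cite: GrossZagier1986, Thm. I.(6.3) and V.§2] [cite: FriedbergHoffstein1995, Thm. B] -/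
theorem wAllExclAddWildRankOneSurj_of_valueAtOneRestricted_of_controlLe (hF : PublishedInputsWildThree)
    (hE1 : ∀ (W : WeierstrassCurve ℚ) [W.IsElliptic] [W.IsGloballyMinimal] (N : ℕ) [NeZero N] (K : Type) [Field K] [NumberField K] (Dt : Literature.NumberTheory.EllipticCurves.ModularForms.ModularParametrizationData W N) (H : Literature.NumberTheory.EllipticCurves.HeegnerDatum N (NumberField.discr K)) (ι : K →+* ℂ) (P : (W.baseChange K).toAffine.Point), Summit.BirchSwinnertonDyer.Rank1Residual.Additive.ClassO6 W 3 → W.HasSurjectiveModNGaloisRep 3 → W.analyticRank = 1 → W.conductorNorm ℤ = N → Literature.NumberTheory.EllipticCurves.IsImaginaryQuadratic K → Literature.NumberTheory.EllipticCurves.SatisfiesHeegnerHypothesis N K → (W.quadraticTwist (NumberField.discr K : ℚ)).entireLFunction 1 ≠ 0 → (WeierstrassCurve.Affine.Point.map ι.toRatAlgHom) P = Literature.NumberTheory.EllipticCurves.ModularForms.heegnerPointComplex Dt H → ¬ IsOfFinAddOrder P → ∀ (κ : Literature.NumberTheory.EllipticCurves.ZpExtension K 3), κ.IsAnticyclotomic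 → ∀ (γ : Field.absoluteGaloisGroup K) [Fact (κ.IsTopGenerator γ)] (𝔭 : IsDedekindDomain.HeightOneSpectrum (NumberField.RingOfIntegers K)), ((3 : ℕ) : NumberField.RingOfIntegers K) ∈ 𝔭.asIdeal → 𝔭.asIdeal.ramificationIdx (NumberField.RingOfIntegers ℚ) = 1 → 𝔭.asIdeal.inertiaDeg (NumberField.RingOfIntegers ℚ) = 1 → ∀ (𝔭' : IsDedekindDomain.HeightOneSpectrum (NumberField.RingOfIntegers K)), ((3 : ℕ) : NumberField.RingOfIntegers K) ∈ 𝔭'.asIdeal → 𝔭' ≠ 𝔭 → ∀ (ι' : PadicAlgCl 3 ≃+* ℂ), Summit.BirchSwinnertonDyer.BirchSwinnertonDyer.Theorems.SchneiderFree.BranchInducesPrime 3 ι' 𝔭 → ∀ (ΩK : ℂ) (Ωp : ℂ_[3]) (L : Literature.NumberTheory.EllipticCurves.UnrSeries 3), ΩK ≠ 0 → Ωp ≠ 0 → Literature.NumberTheory.EllipticCurves.IsBDPLFunction ι' 𝔭 κ γ Dt.f ΩK Ωp L → Module.IsTorsion (Literature.NumberTheory.EllipticCurves.IwasawaAlgebra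 3) (Summit.BirchSwinnertonDyer.Rank1Residual.X11b.AcSelmer.XAc (W.baseChange K) 3 κ 𝔭' ∅ γ) → ∀ (f : Literature.NumberTheory.EllipticCurves.IwasawaAlgebra 3), Summit.BirchSwinnertonDyer.Rank1Residual.X11b.AcSelmer.XAc.charIdeal (W.baseChange K) 3 κ 𝔭' ∅ γ = Ideal.span {f} → ‖((PowerSeries.constantCoeff f : ℤ_[3]) : ℚ_[3])‖ ≤ ‖((PowerSeries.constantCoeff L : Literature.NumberTheory.EllipticCurves.unrIntegers 3) : ℂ_[3])‖)
    (hKoly : WildKolyvaginUpperAtThree) (hV : WildSplitWaldspurgerAtThree)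
    (hCle : ∀ (W : WeierstrassCurve ℚ) [W.IsElliptic] [W.IsGloballyMinimal] (N : ℕ) [NeZero N] (K : Type)
      [Field K] [NumberField K] (Dt : ModularParametrizationData W N)
      (H : HeegnerDatum N (NumberField.discr K)) (ι : K →+* ℂ) (P : (W.baseChange K).toAffine.Point),
      ClassO6 W 3 → W.HasSurjectiveModNGaloisRep 3 → W.analyticRank = 1 → W.conductorNorm ℤ = N →
      IsImaginaryQuadratic K → SatisfiesHeegnerHypothesis N K →
      (W.quadraticTwist (NumberField.discr K : ℚ)).entireLFunction 1 ≠ 0 →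
      WeierstrassCurve.Affine.Point.map ι.toRatAlgHom P = heegnerPointComplex Dt H →
      ¬ IsOfFinAddOrder P → kolyvagin N W K →
      ∀ (κ : ZpExtension K 3), κ.IsAnticyclotomic →
        ∀ (γ : Field.absoluteGaloisGroup K) [Fact (κ.IsTopGenerator γ)]
          (𝔭 : HeightOneSpectrum (𝓞 K)) (h𝔭 : ((3 : ℕ) : 𝓞 K) ∈ 𝔭.asIdeal)
          (he : 𝔭.asIdeal.ramificationIdx (𝓞 ℚ) = 1) (hf : 𝔭.asIdeal.inertiaDeg (𝓞 ℚ) = 1),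
          AdditiveControlLeOnTreeAt 3 κ 𝔭 γ (embAt K 3 𝔭 h𝔭 he hf) 0 P)
    (hZ : WildRankZeroTwistAtThree) (hNT : WildRankOneSurjNonTowerAtThree) :
    Summit.BirchSwinnertonDyer.WAllExclAddWildRankOneSurj := by
  unfold Summit.BirchSwinnertonDyer.WAllExclAddWildRankOneSurj
  intro W _ _ hncm hO6 hsurj hr
  -- (o) TOWER SPLIT: off the tower-surjective rows the residual crux pays by name
  by_cases htower : AdditiveThree.TowerSurjThree W
  swap
  · exact hNT W hncm hO6 hsurj htower hr
  obtain ⟨hGZ, hKo, hGZK, hmod, hmodP, -, hGZ73, hFH, hpar, hHP⟩ := hF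
  haveI hN0 : NeZero (W.conductorNorm ℤ) := ⟨W.conductorNorm_pos_holds.ne'⟩
  -- (a) DATA. parity: `r_an = 1` is odd, so `w(E) = -1`
  have hw : W.rootNumber = -1 := by
    rcases W.rootNumber_eq_one_or with h | h
    · exfalso
      have heven : Even W.analyticRank := (hpar W).mpr h
      rw [hr] at heven
      exact Nat.not_even_one heven
    · exact h
  -- Friedberg–Hoffstein with auxiliary modulus `2`: Heegner for `N(E)`, `2` split, `L(E^{(d_K)},1) ≠ 0`
  obtain ⟨K, _, _, hK, -, hHN, hH2, hLt⟩ := hFH W hw 2 two_ne_zero 0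
  have hodd : Odd (NumberField.discr K) := by
    have h8 := Literature.SatisfiesHeegnerHypothesis.discr_emod_eight hK.1 hH2 (dvd_refl 2)
    rw [Int.odd_iff]; omega
  -- `3 ∣ N(E)` (additive) splits in `K`; hence `d_K ≠ -3`
  have h3N : 3 ∣ W.conductorNorm ℤ :=
    (W.dvd_conductorNorm_iff_not_hasGoodReductionAtPrime 3).mpr (not_good_of_addv W 3 hO6.2.1)
  have hsplit : SplitsIn K 3 := hHN 3 Nat.prime_three h3N
  have hd3 : NumberField.discr K ≠ -3 := by
    intro h
    exact Literature.SatisfiesHeegnerHypothesis.not_dvd_discr hK.1 hHN Nat.prime_three h3N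
      (by rw [h]; norm_num)
  -- the Heegner point over `K` and its datum; non-torsion by Gross–Zagier
  obtain ⟨P, Dt, H, ι, hP⟩ := hHP W K hK hHN
  have hL0 : W.entireLFunction 1 = 0 := entireLFunction_one_eq_zero_of_analyticRank_eq_one hr
  obtain ⟨-, hderiv⟩ := leadingLCoeff_eq_deriv_of_analyticRank_eq_one hr
  have hLK : LDerivEK W K ≠ 0 := by
    rw [lDerivEK_eq_deriv_mul W K hmod hL0]; exact mul_ne_zero hderiv hLt
  have hnt : ¬ IsOfFinAddOrder P :=
    (lDerivEK_ne_zero_iff_not_isOfFinAddOrder W (W.conductorNorm ℤ) K (hGZ _ W K) hK hHN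
      ⟨Dt, H, ι, hP⟩).mp hLK
  -- Kolyvagin: `rank E(K) = 1`, `Ш(E/K)` finite
  obtain ⟨hrk, hfin⟩ := hKo (W.conductorNorm ℤ) W K hK hHN ⟨Dt, H, ι, hP⟩ hnt
  -- a frame `(κ, γ, 𝔭)` and the other prime `𝔭′ ≠ 𝔭` above `3`
  obtain ⟨κ, γ, -, hκ, hγ, -⟩ := X11b.exists_anticyclotomic_generator_prime (p := 3) hK
  haveI : Fact (κ.IsTopGenerator γ) := ⟨hγ⟩
  obtain ⟨𝔭, h𝔭, he, hf⟩ := X11b.exists_degreeOnePrime_of_splitsIn K 3 hK.1 hsplit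
  obtain ⟨𝔭', hne, h𝔭', he', hf'⟩ := X11b.Three.exists_ne_degreeOne_prime hK.1 h𝔭 he hf
  -- (b) PLUMBING. Waldspurger frame and unit value at `(κ, γ, 𝔭)`
  obtain ⟨ι', hind, ΩK, Ωp, L, hΩK, hΩp, hBDP, u, hval⟩ :=
    hV W (W.conductorNorm ℤ) K Dt H ι P hO6 hsurj hr rfl hK hHN hLt hP hnt κ hκ γ 𝔭 h𝔭 he hf
  -- the control INEQUALITY at `𝔭′` (CTL₀ included; supplies the torsion guard of the Eisenstein residual)
  have hctl : AdditiveControlLeOnTreeAt 3 κ 𝔭' γ (embAt K 3 𝔭' h𝔭' he' hf') 0 P :=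
    hCle W (W.conductorNorm ℤ) K Dt H ι P hO6 hsurj hr rfl hK hHN hLt hP hnt (hKo _ W K) κ hκ γ 𝔭'
      h𝔭' he' hf'
  obtain ⟨n, hn, hnle⟩ := hctl
  -- the value read through the logarithm at `𝔭′` (rank one: `(log_{𝔭′} P)² = (log_𝔭 P)²`)
  have hval' : L.HasValueAt 0 ((((u : unrIntegers 3) : unrIntegers 3) : ℂ_[3]) *
      (algebraMap ℚ_[3] ℂ_[3]
        (logOmega W 3 (embAt K 3 𝔭' h𝔭' he' hf') P / (Dt.c : ℚ_[3]))) ^ 2) :=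
    (SchneiderFreeAdditiveX3.hasValueAt_sq_logOmega_embAt_iff_of_rank_one W 3 hK.1 hrk h𝔭 he hf
      h𝔭' he' hf' P _ _ L).mpr hval
  -- the LOWER socket at slack `v₃(c)` at the frame `(κ, 𝔭′, γ, embAt 𝔭′)` — from `E_𝟙′`
  have hc0 : Dt.c ≠ 0 := Dt.maninConstant_ne_zero_holds
  have hlog : logOmega W 3 (embAt K 3 𝔭' h𝔭' he' hf') P ≠ 0 := X11b.R1.logOmega_ne_zero W 3 _ hnt
  have hlow : SchneiderFree.AdditiveIMCLowerBDPOnTreeLeAt 3 κ 𝔭' γ (embAt K 3 𝔭' h𝔭' he' hf')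
      (padicValNat 3 Dt.c.natAbs) P := by
    obtain ⟨htors, f, hfI, hf0, hfn⟩ := hn
    -- `E_𝟙′` at the frame, WITH the datum the kernel holds here: `‖f(𝟙)‖₃ ≤ ‖L(𝟙)‖`
    have hle1 : ‖((constantCoeff f : ℤ_[3]) : ℚ_[3])‖ ≤ ‖((constantCoeff L : unrIntegers 3) : ℂ_[3])‖ :=
      hE1 W (W.conductorNorm ℤ) K Dt H ι P hO6 hsurj hr rfl hK hHN hLt hP hnt κ hκ γ 𝔭 h𝔭 he hf 𝔭' h𝔭'
        hne ι' hind ΩK Ωp L hΩK hΩp hBDP htors f hfI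
    obtain ⟨-, hle⟩ := two_mul_valuation_le_of_norm_constantCoeff_le 3 hf0 hle1 u hval'
    have hc0' : (Dt.c : ℚ_[3]) ≠ 0 := by exact_mod_cast hc0
    rw [div_eq_mul_inv, Padic.valuation_mul hlog (inv_ne_zero hc0'), Padic.valuation_inv,
      Padic.valuation_intCast, valuation_logOmega hlog, hfn] at hle
    refine ⟨n, ⟨htors, f, hfI, hf0, hfn⟩, ?_⟩
    simp only [padicValInt] at hle
    linarith
  -- STEP L by the `≤` link: NO control equality is used anywhere in this kernel
  have hlo : SchneiderFree.IndexLowerBoundLeAt W 3 K P (padicValNat 3 Dt.c.natAbs) :=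
    indexLowerBoundLeAt_of_imcLowerLe_of_controlLe_zero rfl hK hHN hfin hlow ⟨n, hn, hnle⟩
  -- the UPPER socket at slack `v₃(c)` IS the Kolyvagin crux (tower surjectivity, `d_K` odd, `≠ -3`)
  have hupI : SchneiderFree.Upper.IndexUpperBoundLeAt W 3 K P (padicValNat 3 Dt.c.natAbs) :=
    hKoly W (W.conductorNorm ℤ) K Dt H ι P hO6 hsurj hr rfl hK hHN hLt hP hnt hodd hd3 htower
  -- (c) TERMINAL STEP: a globally minimal model of the twist, then p528981
  have hD0 : (NumberField.discr K : ℚ) ≠ 0 := by exact_mod_cast NumberField.discr_ne_zero K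
  haveI : (W.quadraticTwist (NumberField.discr K : ℚ)).IsElliptic := W.isElliptic_quadraticTwist hD0
  obtain ⟨Cd, hCd⟩ := hasGlobalMinimalModel_rat_holds (W.quadraticTwist (NumberField.discr K : ℚ))
  haveI : (Cd • W.quadraticTwist (NumberField.discr K : ℚ)).IsGloballyMinimal := hCd
  exact SchneiderFree.Exact.bsdp_three_of_exactIndexManin_of_wAllExclAddWildRankZero hGZ hKo hGZK hmod
    hGZ73 hZ W hO6 hsurj hr (W.conductorNorm ℤ) K Dt H ι P
    (Cd • W.quadraticTwist (NumberField.discr K : ℚ)) rfl hK hodd hHN hLt hP ⟨Cd, rfl⟩ hlo hupI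

/-- **SOED's leaf from the RESTRICTED crux `E′` (24155) with control as `≤`**: `PublishedInputsWildThree → E′ →
WildKolyvaginUpperAtThree → WildSplitWaldspurgerAtThree → [≤-control] → WildRankZeroTwistAtThree → WildRankOneSurjNonTowerAtThree →
WAllExclAddWildRankOneSurj`. [cite: JetchevSkinnerWan2017, §7.4.1 (arXiv:1512.06894 p. 30)] -/
theorem wAllExclAddWildRankOneSurj_of_restricted_of_controlLe (hF : PublishedInputsWildThree)
    (hE' : ∀ (W : WeierstrassCurve ℚ) [W.IsElliptic] [W.IsGloballyMinimal] (N : ℕ) [NeZero N] (K : Type) [Field K] [NumberField K] (Dt : Literature.NumberTheory.EllipticCurves.ModularForms.ModularParametrizationData W N) (H : Literature.NumberTheory.EllipticCurves.HeegnerDatum N (NumberField.discr K)) (ι : K →+* ℂ) (P : (W.baseChange K).toAffine.Point), Summit.BirchSwinnertonDyer.Rank1Residual.Additive.ClassO6 W 3 → W.HasSurjectiveModNGaloisRep 3 → W.analyticRank = 1 → W.conductorNorm ℤ = N → Literature.NumberTheory.EllipticCurves.IsImaginaryQuadratic K → Literature.NumberTheory.EllipticCurves.SatisfiesHeegnerHypothesis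 N K → (W.quadraticTwist (NumberField.discr K : ℚ)).entireLFunction 1 ≠ 0 → (WeierstrassCurve.Affine.Point.map ι.toRatAlgHom) P = Literature.NumberTheory.EllipticCurves.ModularForms.heegnerPointComplex Dt H → ¬ IsOfFinAddOrder P → ∀ (κ : Literature.NumberTheory.EllipticCurves.ZpExtension K 3), κ.IsAnticyclotomic → ∀ (γ : Field.absoluteGaloisGroup K) [Fact (κ.IsTopGenerator γ)] (𝔭 : IsDedekindDomain.HeightOneSpectrum (NumberField.RingOfIntegers K)), ((3 : ℕ) : NumberField.RingOfIntegers K) ∈ 𝔭.asIdeal → 𝔭.asIdeal.ramificationIdx (NumberField.RingOfIntegers ℚ) = 1 → 𝔭.asIdeal.inertiaDeg (NumberField.RingOfIntegers ℚ) = 1 → ∀ (𝔭' : IsDedekindDomain.HeightOneSpectrum (NumberField.RingOfIntegers K)), ((3 : ℕ) : NumberField.RingOfIntegers K) ∈ 𝔭'.asIdeal → 𝔭' ≠ 𝔭 → ∀ (ι' : PadicAlgCl 3 ≃+* ℂ), Summit.BirchSwinnertonDyer.BirchSwinnertonDyer.Theorems.SchneiderFree.BranchInducesPrime 3 ι' 𝔭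 → ∀ (ΩK : ℂ) (Ωp : ℂ_[3]) (L : Literature.NumberTheory.EllipticCurves.UnrSeries 3), ΩK ≠ 0 → Ωp ≠ 0 → Literature.NumberTheory.EllipticCurves.IsBDPLFunction ι' 𝔭 κ γ Dt.f ΩK Ωp L → Module.IsTorsion (Literature.NumberTheory.EllipticCurves.IwasawaAlgebra 3) (Summit.BirchSwinnertonDyer.Rank1Residual.X11b.AcSelmer.XAc (W.baseChange K) 3 κ 𝔭' ∅ γ) → (Summit.BirchSwinnertonDyer.Rank1Residual.X11b.AcSelmer.XAc.charIdeal (W.baseChange K) 3 κ 𝔭' ∅ γ).map (PowerSeries.map (Summit.BirchSwinnertonDyer.Rank1Residual.X11b.Halves.toUnr 3)) ≤ Ideal.span {L})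
    (hKoly : WildKolyvaginUpperAtThree) (hV : WildSplitWaldspurgerAtThree)
    (hCle : ∀ (W : WeierstrassCurve ℚ) [W.IsElliptic] [W.IsGloballyMinimal] (N : ℕ) [NeZero N] (K : Type)
      [Field K] [NumberField K] (Dt : ModularParametrizationData W N)
      (H : HeegnerDatum N (NumberField.discr K)) (ι : K →+* ℂ) (P : (W.baseChange K).toAffine.Point),
      ClassO6 W 3 → W.HasSurjectiveModNGaloisRep 3 → W.analyticRank = 1 → W.conductorNorm ℤ = N →
      IsImaginaryQuadratic K → SatisfiesHeegnerHypothesis N K →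
      (W.quadraticTwist (NumberField.discr K : ℚ)).entireLFunction 1 ≠ 0 →
      WeierstrassCurve.Affine.Point.map ι.toRatAlgHom P = heegnerPointComplex Dt H →
      ¬ IsOfFinAddOrder P → kolyvagin N W K →
      ∀ (κ : ZpExtension K 3), κ.IsAnticyclotomic →
        ∀ (γ : Field.absoluteGaloisGroup K) [Fact (κ.IsTopGenerator γ)]
          (𝔭 : HeightOneSpectrum (𝓞 K)) (h𝔭 : ((3 : ℕ) : 𝓞 K) ∈ 𝔭.asIdeal)
          (he : 𝔭.asIdeal.ramificationIdx (𝓞 ℚ) = 1) (hf : 𝔭.asIdeal.inertiaDeg (𝓞 ℚ) = 1),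
          AdditiveControlLeOnTreeAt 3 κ 𝔭 γ (embAt K 3 𝔭 h𝔭 he hf) 0 P)
    (hZ : WildRankZeroTwistAtThree) (hNT : WildRankOneSurjNonTowerAtThree) :
    Summit.BirchSwinnertonDyer.WAllExclAddWildRankOneSurj :=
  wAllExclAddWildRankOneSurj_of_valueAtOneRestricted_of_controlLe hF (valueAtOneRestricted_of_restricted hE') hKoly hV
    hCle hZ hNT

/-! ## §2 Crux #5 replaced by PT1 in SOED's deciding chain -/

/-- **SOED's `closes` chain with crux #5 REPLACED BY PT1.** `PublishedInputsWildThree → E′ (24155) → Ko (20480) → V (20385) →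
(∀ K, poitouTate_selmerStructure_duality K) → Z (20387) → NT (20484) → WAllExclAddWildRankOneSurj`: the shared control crux
`WildSplitControlAtThree` (stmt-BirchSwinnertonDyer-20386) no longer occurs — its `≤` half, the only part the kernel consumes, is
supplied by `UniversalToricDescentLowerHalf.wildSplitControlLeAtThree_of_poitouTate` from PT1 alone (Kolyvagin being the datum's
antecedent, which the kernel obtains from `PublishedInputsWildThree`). So for route SOED crux #5 is, as far as the deciding theorem
is concerned, a BY-NAME published fact (Milne *ADT* I 4.10(b) / Howard Thm. 2.1.11) — `poitouTate_sha_tateDual`, Serre 1967 /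
Fin_v, Brink, the `E(ℚ₃)[3]` case split are all gone. CONDITIONAL on the displayed antecedents; BSD is not proved by this.
[cite: JetchevSkinnerWan2017, §7.4.1 and Thm. 3.3.1 (arXiv:1512.06894 pp. 11, 30)] [cite: MilneADT2006, Ch. I, Thm. 4.10(b)]
[cite: Howard2004HeegnerKolyvagin, Thm. 2.1.11 (arXiv:1202.6340 p. 6)] -/
theorem wAllExclAddWildRankOneSurj_of_restricted_of_poitouTate (hF : PublishedInputsWildThree)
    (hE' : ∀ (W : WeierstrassCurve ℚ) [W.IsElliptic] [W.IsGloballyMinimal] (N : ℕ) [NeZero N] (K : Type) [Field K] [NumberField K] (Dt : Literature.NumberTheory.EllipticCurves.ModularForms.ModularParametrizationData W N) (H : Literature.NumberTheory.EllipticCurves.HeegnerDatum N (NumberField.discr K)) (ι : K →+* ℂ) (P : (W.baseChange K).toAffine.Point), Summit.BirchSwinnertonDyer.Rank1Residual.Additive.ClassO6 W 3 → W.HasSurjectiveModNGaloisRep 3 → W.analyticRank = 1 → W.conductorNorm ℤ = N → Literature.NumberTheory.EllipticCurves.IsImaginaryQuadratic K → Literature.NumberTheory.EllipticCurves.SatisfiesHeegnerHypothesis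 N K → (W.quadraticTwist (NumberField.discr K : ℚ)).entireLFunction 1 ≠ 0 → (WeierstrassCurve.Affine.Point.map ι.toRatAlgHom) P = Literature.NumberTheory.EllipticCurves.ModularForms.heegnerPointComplex Dt H → ¬ IsOfFinAddOrder P → ∀ (κ : Literature.NumberTheory.EllipticCurves.ZpExtension K 3), κ.IsAnticyclotomic → ∀ (γ : Field.absoluteGaloisGroup K) [Fact (κ.IsTopGenerator γ)] (𝔭 : IsDedekindDomain.HeightOneSpectrum (NumberField.RingOfIntegers K)), ((3 : ℕ) : NumberField.RingOfIntegers K) ∈ 𝔭.asIdeal → 𝔭.asIdeal.ramificationIdx (NumberField.RingOfIntegers ℚ) = 1 → 𝔭.asIdeal.inertiaDeg (NumberField.RingOfIntegers ℚ) = 1 → ∀ (𝔭' : IsDedekindDomain.HeightOneSpectrum (NumberField.RingOfIntegers K)), ((3 : ℕ) : NumberField.RingOfIntegers K) ∈ 𝔭'.asIdeal → 𝔭' ≠ 𝔭 → ∀ (ι' : PadicAlgCl 3 ≃+* ℂ), Summit.BirchSwinnertonDyer.BirchSwinnertonDyer.Theorems.SchneiderFree.BranchInducesPrime 3 ι' 𝔭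 → ∀ (ΩK : ℂ) (Ωp : ℂ_[3]) (L : Literature.NumberTheory.EllipticCurves.UnrSeries 3), ΩK ≠ 0 → Ωp ≠ 0 → Literature.NumberTheory.EllipticCurves.IsBDPLFunction ι' 𝔭 κ γ Dt.f ΩK Ωp L → Module.IsTorsion (Literature.NumberTheory.EllipticCurves.IwasawaAlgebra 3) (Summit.BirchSwinnertonDyer.Rank1Residual.X11b.AcSelmer.XAc (W.baseChange K) 3 κ 𝔭' ∅ γ) → (Summit.BirchSwinnertonDyer.Rank1Residual.X11b.AcSelmer.XAc.charIdeal (W.baseChange K) 3 κ 𝔭' ∅ γ).map (PowerSeries.map (Summit.BirchSwinnertonDyer.Rank1Residual.X11b.Halves.toUnr 3)) ≤ Ideal.span {L})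
    (hKoly : WildKolyvaginUpperAtThree) (hV : WildSplitWaldspurgerAtThree)
    (hPT : ∀ (K : Type) [Field K] [NumberField K], poitouTate_selmerStructure_duality K)
    (hZ : WildRankZeroTwistAtThree) (hNT : WildRankOneSurjNonTowerAtThree) :
    Summit.BirchSwinnertonDyer.WAllExclAddWildRankOneSurj :=
  wAllExclAddWildRankOneSurj_of_restricted_of_controlLe hF hE' hKoly hV
    (fun W _ _ N _ K _ _ Dt H ι P hO6 hsurj hr hN hK hHe hLt hP hnt hKo κ hκ γ _ 𝔭 h𝔭 he hf ↦
      UniversalToricDescentLowerHalf.wildSplitControlLeAtThree_of_poitouTate hPT W N K Dt H ι P hO6 hsurj hr hN hK hHe hLt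
        hP hnt hKo κ hκ γ 𝔭 h𝔭 he hf)
    hZ hNT

/-- **The original kernel chain (crux E, 20479) with crux #5 replaced by PT1**: `PublishedInputsWildThree →
WildSplitEisensteinInclusionAtThree → WildKolyvaginUpperAtThree → WildSplitWaldspurgerAtThree → (∀ K, poitouTate_selmerStructure_duality K)
→ WildRankZeroTwistAtThree → WildRankOneSurjNonTowerAtThree → WAllExclAddWildRankOneSurj` (E ⟹ E′ by `restricted_of_crux`).
[cite: JetchevSkinnerWan2017, §7.4.1 (arXiv:1512.06894 p. 30)] [cite: MilneADT2006, Ch. I, Thm. 4.10(b)] -/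
theorem wAllExclAddWildRankOneSurj_of_eisenstein_of_poitouTate (hF : PublishedInputsWildThree)
    (hE : WildSplitEisensteinInclusionAtThree) (hKoly : WildKolyvaginUpperAtThree) (hV : WildSplitWaldspurgerAtThree)
    (hPT : ∀ (K : Type) [Field K] [NumberField K], poitouTate_selmerStructure_duality K)
    (hZ : WildRankZeroTwistAtThree) (hNT : WildRankOneSurjNonTowerAtThree) :
    Summit.BirchSwinnertonDyer.WAllExclAddWildRankOneSurj :=
  wAllExclAddWildRankOneSurj_of_restricted_of_poitouTate hF (restricted_of_crux hE) hKoly hV hPT hZ hNT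

end Summit.BirchSwinnertonDyer.BirchSwinnertonDyer.Theorems.SemiOrdinaryEisensteinDescentControlLe

end
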